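import Summits.ABC.IUTFork.Cor312ThetaSlotExactK
import Summits.ABC.IUTFork.Cor312ProvKIdeles
import HarnessLib

/-!
# [IUTchIII] Cor. 3.12 IN READING (P) at the `K`-level sharp setting of the CHOSEN realising ideles — the γ certificate's READ-P binder, as a theorem:
# `(settingPrVolSharp (pilotDataOfK T.D T.K) … q̲.choose Θ̲.choose _ _).negLogThetaSlot ≤ ↑T.negLogThetaPerImage` for every genuine Θ-volume datum `T`

PROOF-ONLY file (D-0012; no definitions, no `Prop` facts) of the abc-iut cell (R2 S-chain team, seat abc-iut-s2-p7 gen 3, CLAIM «HΘP-K»). TAKES NO SIDE on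
[IUTchIII] Cor. 3.12 or on the reading (U)/(P) of `−|log(Θ)|`. The binder `hReadP` of abc-iut-C-cert-2's γ certificate
`Conditional.abc_of_slotLicence_orNumP_K_szpiroBad` (`AbcOfSlotLicenceGenuineK`, p458998) reads the sharp `K`-setting at the CHOSEN realising ideles
(abc-iut-c312-8 `exists_realising_qIdeles_pilotDataOfK` / `exists_realising_thetaIdeles_pilotDataOfK`, [IUTchI] Ex. 3.2 (iv): `q̲_v` is ANY `2l`-th root); this
file specialises `Cor312ThetaSlotExactK.negLogThetaSlot_settingPrVolSharp_pilotDataOfK_le_negLogThetaPerImage_of_isVolumeInputOf` (EVERY realising Θ-idele) to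
that choice, so that `hReadP := fun P l T => negLogThetaSlot_settingPrVolSharp_pilotDataOfK_chosen_le_datum T (M P l T) (archPk P l T) … (qData P l T)`.
[cite: Mochizuki2012, IUTchIII Cor. 3.12 proof Step (x) p. 181] [cite: Mochizuki2012, IUTchIV Thm. 1.10 Steps (v)–(viii) p. 27–31] [cite: Mochizuki2012,
IUTchI Ex. 3.2 (iv) p. 71] [cite: DupuyHilado2025, §3.9, §4.11–4.12] [claim: Mochizuki2012, status: disputed] for every quoted construction. HONEST FRAMING: an
inequality between OUR typings (the nonarchimedean part is an EQUALITY, `Cor312ThetaSlotExactK`; the slack is exactly `((l+5)/4)·log π`); nothing here asserts or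
denies Cor. 3.12 for any initial Θ-data, asserts the γ certificate's other binder, or takes a side on any author; typed ≠ proved; instantiated ≠ endorsed.
-/

noncomputable section

open Set Function NumberField IsDedekindDomain

namespace Summit.ABC.IUTFork.Thm311.Real

open Cor312 Cor312Vol Cor312Prov Literature.IUT.LogThetaLattice Literature.IUT.LogVolume Literature.IUT.HodgeTheaters
  Literature.NumberTheory.NumberFields

/-! ## At a genuine Θ-volume DATUM: every realising Θ-idele, then the CHOSEN ones (the binder shape of the γ certificate's `hReadP`) -/

/-- **At a datum `T : Cor22.ThetaVolumeDatumAt P l`**: for every context of abc-iut-c312-7's sharp setting over `T.K` at the pilot datum `pilotDataOfK T.D T.K`,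
ANY `q`-ideles and EVERY realising Θ-idele, `(settingPrVolSharp (pilotDataOfK T.D T.K) … tq t _ _).negLogThetaSlot = ↑T.I.negLogThetaPerImageNonarch` and
`≤ ↑T.negLogThetaPerImage` (`T.negLogThetaPerImage = T.I.negLogThetaPerImageNonarch + ((l+5)/4)·log π`). [cite: Mochizuki2012, IUTchIII Cor. 3.12 proof
Step (x) p. 181] [cite: Mochizuki2012, IUTchIV Thm. 1.10 Steps (v)–(viii) p. 27–31] -/
theorem negLogThetaSlot_settingPrVolSharp_pilotDataOfK_le_datum
    {P : Literature.NumberTheory.DiophantineGeometry.GenEll.NFPoint} {l : ℕ} (T : Cor22.ThetaVolumeDatumAt P l) :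
    letI := T.instFieldF; letI := T.instNumberFieldF; letI := T.instAlgebraF; letI := T.instFieldK;
    letI := T.instNumberFieldK; letI := T.instAlgebraK; letI := T.instFieldFbar; letI := T.instAlgebraFbar;
    letI := T.instAlgebraKFbar; letI := T.instIsElliptic;
    ∀ (M : Type) [Field M] [NumberField M]
      (archPk : ∀ (j : (thetaIndex (pilotDataOfK T.D T.K)).Label) (vQ : (thetaIndex (pilotDataOfK T.D T.K)).VQ),
        Set ((logShellsDH (pilotDataOfK T.D T.K) (analyticLogv T.K)).Packet j vQ))
      (archSub : ∀ (j : (thetaIndex (pilotDataOfK T.D T.K)).Label) (v : (thetaIndex (pilotDataOfK T.D T.K)).V),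
        Set ((logShellsDH (pilotDataOfK T.D T.K) (analyticLogv T.K)).Packet j ((thetaIndex (pilotDataOfK T.D T.K)).over v)))
      (Ψ : ℤ → ∀ v : (thetaIndex (pilotDataOfK T.D T.K)).V, v ∈ (thetaIndex (pilotDataOfK T.D T.K)).Vbad →
        Set ((logShellsDH (pilotDataOfK T.D T.K) (analyticLogv T.K)).StarPacket v))
      (act : ℤ → ∀ v : (thetaIndex (pilotDataOfK T.D T.K)).V, v ∈ (thetaIndex (pilotDataOfK T.D T.K)).Vbad →
        (logShellsDH (pilotDataOfK T.D T.K) (analyticLogv T.K)).StarPacket v →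
          Module.End ℚ ((logShellsDH (pilotDataOfK T.D T.K) (analyticLogv T.K)).StarPacket v))
      (Mmod : ℤ → ∀ j : (thetaIndex (pilotDataOfK T.D T.K)).LabelStar,
        Set ((logShellsDH (pilotDataOfK T.D T.K) (analyticLogv T.K)).GlobalPacket j.1))
      (region : ℤ → ∀ j : (thetaIndex (pilotDataOfK T.D T.K)).LabelStar, FinDivisor M →
        ∀ vQ : (thetaIndex (pilotDataOfK T.D T.K)).VQ, Set ((logShellsDH (pilotDataOfK T.D T.K) (analyticLogv T.K)).Packet j.1 vQ))
      (n : ℤ) {HT : Type} {LogLink : HT → HT → Type} {IsFull : ∀ {s t : HT}, LogLink s t → Prop}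
      (lat : LGPGaussianLogThetaLattice LogLink IsFull)
      {Frd : Type} {IsoF : Frd → Frd → Type} {Ob : Frd → Type} {realify : Frd → Frd} {Strip : Type}
      {IsoS : Strip → Strip → Type}
      {Mv : ∀ v : (thetaIndex (pilotDataOfK T.D T.K)).V, v ∈ (thetaIndex (pilotDataOfK T.D T.K)).Vbad → Type}
      [∀ v h, Monoid (Mv v h)]
      (sig : GlobalLGPFrobenioidSignature (thetaIndex (pilotDataOfK T.D T.K)).lstar (thetaIndex (pilotDataOfK T.D T.K)).V
        (· ∈ (thetaIndex (pilotDataOfK T.D T.K)).Vbad) Frd IsoF Ob realify Strip IsoS Mv)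
      (split : SplittingMonoids Mv) {ObΔ : Type}
      {N : ∀ v : (thetaIndex (pilotDataOfK T.D T.K)).V, v ∈ (thetaIndex (pilotDataOfK T.D T.K)).Vbad → Type} [∀ v h, Monoid (N v h)]
      (qData : QPilotData ObΔ N)
      (tq : ∀ (pp : Nat.Primes) (x : (thetaIndex (pilotDataOfK T.D T.K)).Fibre (.inr pp)),
        haveI : Fact (pp : ℕ).Prime := ⟨pp.2⟩; kOf (pilotDataOfK T.D T.K) pp.1 x)
      (t : ∀ (pp : Nat.Primes) (_ : Fin (pilotDataOfK T.D T.K).lstar) (x : (thetaIndex (pilotDataOfK T.D T.K)).Fibre (.inr pp)),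
        haveI : Fact (pp : ℕ).Prime := ⟨pp.2⟩; kOf (pilotDataOfK T.D T.K) pp.1 x)
      (htq0 : ∀ pp x, tq pp x ≠ 0)
      (htq1 : ∀ (pp : Nat.Primes) (x : (thetaIndex (pilotDataOfK T.D T.K)).Fibre (.inr pp)),
        haveI : Fact (pp : ℕ).Prime := ⟨pp.2⟩; placeOf (pilotDataOfK T.D T.K) pp.1 x ∉ (pilotDataOfK T.D T.K).S → ‖tq pp x‖ = 1),
      (∀ pp i x, t pp i x ≠ 0) →
      (∀ (pp : Nat.Primes) (i : Fin (pilotDataOfK T.D T.K).lstar) (x : (thetaIndex (pilotDataOfK T.D T.K)).Fibre (.inr pp)),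
        haveI : Fact (pp : ℕ).Prime := ⟨pp.2⟩
        Real.log ‖t pp i x‖ = -((pilotDataOfK T.D T.K).thetaPilot i (placeOf (pilotDataOfK T.D T.K) pp.1 x)) *
          logNorm T.K (placeOf (pilotDataOfK T.D T.K) pp.1 x) / localDegree T.K (placeOf (pilotDataOfK T.D T.K) pp.1 x)) →
      (settingPrVolSharp (pilotDataOfK T.D T.K) (logvAnalytic_analyticLogv (F := T.K)) M archPk archSub Ψ act Mmod region n lat
          sig split qData tq t htq0 htq1).negLogThetaSlot = ((T.I.negLogThetaPerImageNonarch : ℝ) : WithTop ℝ) ∧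
      (settingPrVolSharp (pilotDataOfK T.D T.K) (logvAnalytic_analyticLogv (F := T.K)) M archPk archSub Ψ act Mmod region n lat
          sig split qData tq t htq0 htq1).negLogThetaSlot ≤ ((T.negLogThetaPerImage : ℝ) : WithTop ℝ) := by
  intro M _ _ archPk archSub Ψ act Mmod region n HT LogLink IsFull lat Frd IsoF Ob realify Strip IsoS Mv _ sig split ObΔ N _ qData
    tq t htq0 htq1 ht0 hT
  letI := T.instFieldF; letI := T.instNumberFieldF; letI := T.instAlgebraF; letI := T.instFieldK
  letI := T.instNumberFieldK; letI := T.instAlgebraK; letI := T.instFieldFbar; letI := T.instAlgebraFbar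
  letI := T.instAlgebraKFbar; letI := T.instIsElliptic
  exact ⟨negLogThetaSlot_settingPrVolSharp_pilotDataOfK_eq_negLogThetaPerImageNonarch_of_isVolumeInputOf T.D M archPk archSub Ψ act Mmod region n
      lat sig split qData tq t htq0 htq1 ht0 hT T.isVolumeInputOf,
    negLogThetaSlot_settingPrVolSharp_pilotDataOfK_le_negLogThetaPerImage_of_isVolumeInputOf T.D M archPk archSub Ψ act Mmod region n lat sig
      split qData tq t htq0 htq1 ht0 hT T.isVolumeInputOf⟩

/-- **THE γ CERTIFICATE'S `hReadP`, DISCHARGED: at the CHOSEN realising ideles** (`exists_realising_qIdeles_pilotDataOfK` / `exists_realising_thetaIdeles_pilotDataOfK`,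
the binder shape of abc-iut-C-cert-2's `Conditional.abc_of_slotLicence_orNumP_K_szpiroBad`, p458998) — for every datum `T` and every context of the sharp
`K`-setting: `(settingPrVolSharp (pilotDataOfK T.D T.K) … q̲.choose Θ̲.choose _ _).negLogThetaSlot ≤ ↑T.negLogThetaPerImage`, so that
`hReadP := fun P l T => negLogThetaSlot_settingPrVolSharp_pilotDataOfK_chosen_le_datum T …`. [cite: Mochizuki2012, IUTchIII Cor. 3.12 proof Step (x) p. 181]
[cite: Mochizuki2012, IUTchIV Thm. 1.10 Steps (v)–(viii) p. 27–31] [cite: Mochizuki2012, IUTchI Ex. 3.2 (iv) p. 71] -/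
theorem negLogThetaSlot_settingPrVolSharp_pilotDataOfK_chosen_le_datum
    {P : Literature.NumberTheory.DiophantineGeometry.GenEll.NFPoint} {l : ℕ} (T : Cor22.ThetaVolumeDatumAt P l) :
    letI := T.instFieldF; letI := T.instNumberFieldF; letI := T.instAlgebraF; letI := T.instFieldK;
    letI := T.instNumberFieldK; letI := T.instAlgebraK; letI := T.instFieldFbar; letI := T.instAlgebraFbar;
    letI := T.instAlgebraKFbar; letI := T.instIsElliptic;
    ∀ (M : Type) [Field M] [NumberField M]
      (archPk : ∀ (j : (thetaIndex (pilotDataOfK T.D T.K)).Label) (vQ : (thetaIndex (pilotDataOfK T.D T.K)).VQ),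
        Set ((logShellsDH (pilotDataOfK T.D T.K) (analyticLogv T.K)).Packet j vQ))
      (archSub : ∀ (j : (thetaIndex (pilotDataOfK T.D T.K)).Label) (v : (thetaIndex (pilotDataOfK T.D T.K)).V),
        Set ((logShellsDH (pilotDataOfK T.D T.K) (analyticLogv T.K)).Packet j ((thetaIndex (pilotDataOfK T.D T.K)).over v)))
      (Ψ : ℤ → ∀ v : (thetaIndex (pilotDataOfK T.D T.K)).V, v ∈ (thetaIndex (pilotDataOfK T.D T.K)).Vbad →
        Set ((logShellsDH (pilotDataOfK T.D T.K) (analyticLogv T.K)).StarPacket v))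
      (act : ℤ → ∀ v : (thetaIndex (pilotDataOfK T.D T.K)).V, v ∈ (thetaIndex (pilotDataOfK T.D T.K)).Vbad →
        (logShellsDH (pilotDataOfK T.D T.K) (analyticLogv T.K)).StarPacket v →
          Module.End ℚ ((logShellsDH (pilotDataOfK T.D T.K) (analyticLogv T.K)).StarPacket v))
      (Mmod : ℤ → ∀ j : (thetaIndex (pilotDataOfK T.D T.K)).LabelStar,
        Set ((logShellsDH (pilotDataOfK T.D T.K) (analyticLogv T.K)).GlobalPacket j.1))
      (region : ℤ → ∀ j : (thetaIndex (pilotDataOfK T.D T.K)).LabelStar, FinDivisor M →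
        ∀ vQ : (thetaIndex (pilotDataOfK T.D T.K)).VQ, Set ((logShellsDH (pilotDataOfK T.D T.K) (analyticLogv T.K)).Packet j.1 vQ))
      (n : ℤ) {HT : Type} {LogLink : HT → HT → Type} {IsFull : ∀ {s t : HT}, LogLink s t → Prop}
      (lat : LGPGaussianLogThetaLattice LogLink IsFull)
      {Frd : Type} {IsoF : Frd → Frd → Type} {Ob : Frd → Type} {realify : Frd → Frd} {Strip : Type}
      {IsoS : Strip → Strip → Type}
      {Mv : ∀ v : (thetaIndex (pilotDataOfK T.D T.K)).V, v ∈ (thetaIndex (pilotDataOfK T.D T.K)).Vbad → Type}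
      [∀ v h, Monoid (Mv v h)]
      (sig : GlobalLGPFrobenioidSignature (thetaIndex (pilotDataOfK T.D T.K)).lstar (thetaIndex (pilotDataOfK T.D T.K)).V
        (· ∈ (thetaIndex (pilotDataOfK T.D T.K)).Vbad) Frd IsoF Ob realify Strip IsoS Mv)
      (split : SplittingMonoids Mv) {ObΔ : Type}
      {N : ∀ v : (thetaIndex (pilotDataOfK T.D T.K)).V, v ∈ (thetaIndex (pilotDataOfK T.D T.K)).Vbad → Type} [∀ v h, Monoid (N v h)]
      (qData : QPilotData ObΔ N),
      (settingPrVolSharp (pilotDataOfK T.D T.K) (logvAnalytic_analyticLogv (F := T.K)) M archPk archSub Ψ act Mmod region n lat sig split qData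
          (exists_realising_qIdeles_pilotDataOfK T.D).choose
          (exists_realising_thetaIdeles_pilotDataOfK T.D).choose
          (exists_realising_qIdeles_pilotDataOfK T.D).choose_spec.1
          (exists_realising_qIdeles_pilotDataOfK T.D).choose_spec.2.1).negLogThetaSlot ≤ ((T.negLogThetaPerImage : ℝ) : WithTop ℝ) := by
  intro M _ _ archPk archSub Ψ act Mmod region n HT LogLink IsFull lat Frd IsoF Ob realify Strip IsoS Mv _ sig split ObΔ N _ qData
  letI := T.instFieldF; letI := T.instNumberFieldF; letI := T.instAlgebraF; letI := T.instFieldK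
  letI := T.instNumberFieldK; letI := T.instAlgebraK; letI := T.instFieldFbar; letI := T.instAlgebraFbar
  letI := T.instAlgebraKFbar; letI := T.instIsElliptic
  exact negLogThetaSlot_settingPrVolSharp_pilotDataOfK_le_negLogThetaPerImage_of_isVolumeInputOf T.D M archPk archSub Ψ act Mmod region n lat sig
    split qData _ _ _ _ (exists_realising_thetaIdeles_pilotDataOfK T.D).choose_spec.1
    (exists_realising_thetaIdeles_pilotDataOfK T.D).choose_spec.2.2 T.isVolumeInputOf

end Summit.ABC.IUTFork.Thm311.Real

end
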